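import Mathlib.RingTheory.Ideal.Maps
import Mathlib.RingTheory.Ideal.Colon
import Mathlib.RingTheory.Ideal.MinimalPrime.Basic
import Mathlib.RingTheory.Ideal.Quotient.Operations
import Mathlib.Algebra.Algebra.Subalgebra.Basic
import Mathlib.Algebra.GroupWithZero.NonZeroDivisors
import HarnessLib

/-!
# Hu 2025 (arXiv:2507.21400v1), §7.2–§7.4 «𝔉-, ϑ-, ℘/ℓ-transforms of Γ-schemes» — Lem. 7.3, Lem. 7.4 (with the
# in-proof sentence C60L75), Lem. 7.5, Cor. 7.6: statements-first typing, file b = `S07GammaSchemes/R109bFTransforms.lean`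
# (common record `GammaTransformChart` + Lem. 7.3) of lit/PARTITION-HU.md row 109; file c = `R109cThetaWpEllTransforms.lean`
# (Lem. 7.4, C60L75, Lem. 7.5, Cor. 7.6) imports it (rung M-Hu-min of the campaign `res-hironaka`, D-0089).
# Provenance: typed for row 109 by res-type-016 (typer of record, M-Hu-min re-point) from res-type-029's FILING-READY
# pre-draft (gen 5/6, split-v2 file (5), sha16 8571ed52f209c1c1; its 24 statements byte-identical, plus ONE OURS sibling
# `GammaTransformChart.gamma0Sat` = the definition reading of «the maximal subset»); every locator re-read on
# chunks `p0057`–`p0059` before filing (T9, Δ = 0). Companion of the I-GA file `R109aGamma.lean` (Def. 7.1/7.2: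
# `gammaIdeal`, `gammaWpIdeal`, `GammaSchemeRing`, `ZGammaIntegral`) — here the Γ-scheme ring enters only as an
# abstract ring `RΓ` with the chart structure map, and «Z_Γ is integral» as the slot `hInt : Prop` (instantiate with
# `ZGammaIntegral 𝔉 Γ`).

**STATUS OF THE SOURCE (D-0012 / D-0089): UNREFEREED PREPRINT UNDER ADJUDICATION.** [Hu2025] = arXiv:2507.21400v1,
held as `paper:arxiv-2507.21400` (TeX chunks; LOCATOR OF RECORD `C<cc>L<l>`; PDF page «p.N»; renders
lit/res-lit-6/hu25/hu25_p134.png VIEWED: Lem. 7.4's items are PRINTED (1)(2)(3) with eq. (7.12) = the relation display;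
p.134 l.1–2 shows eq. numbers (7.9)/(7.10) for displays of Lem. 7.3's proof). Statements below are `def … : Prop`
CANDIDATES tagged `[claim: Hu2025, status: under-review]` — «STATUS: candidate statement under adjudication
(D-0012/D-0089); not asserted»; nothing is proved, nothing is asserted, no declaration takes a side. AI typing, weaker
than expert review.

## Carrier level (PARTITION-HU §1; §4 joints J1/J3/J4)
Lem. 7.3 / 7.4 / 7.5 / Cor. 7.6 have ONE shape: on a chart `𝔙` (coordinate ring `A`, a family of «variables»
`var : V → A`) the transform `Z̃_{•,Γ} ∩ 𝔙` is a closed subscheme (chart ideal `zIdeal`), it has a distinguished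
irreducible component `Z̃†_{•,Γ} ∩ 𝔙` (chart ideal `zDagger`), and there are index sets `Γ̃⁰_𝔙, Γ̃¹_𝔙 ⊂ Var_𝔙`
(resp. `Γ̃⁰_𝔙 ⊂ Var^∨_𝔙` in Lem. 7.5 / Cor. 7.6) such that (1) `Z̃ ∩ 𝔙` «is defined by» `y (y ∈ Γ̃⁰)`, `y − 1 (y ∈ Γ̃¹)`
and the listed binomial/linear families ON THE CHART, with `Γ̃⁰_𝔙` maximal; (2) `Z̃† → Z_Γ` is birational; (3) for
every variable `y`, `Z̃† ∩ 𝔙 ⊂ (y = 0) ⟺ Z̃ ∩ 𝔙 ⊂ (y = 0)`. Typed ONCE as the record `GammaTransformChart V A` +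
Props, then named per lemma. The relation families (`ℬ^gov_𝔙`, `ℬ^ngv_{𝔙,>k}`, `ℬ^frb_𝔙`, `L_{𝔙,𝔉}`, and for Lem. 7.3
the explicit `B_{𝔙,(s,t)}`, `L_{𝔙,F_i}`, `F̄_{𝔙,j}` of C57L117–L124) are DATA `rels : ιrel → A` supplied by rows
103–108 (AS PRINTED = term-wise proper transforms, row 106 `Def5_4`; C60L75); the construction clause `C60L53`
reads «proper transform of Z̃» as the STRICT transform of the previous stage (standard), which with `C60L75` gives the
J3 packet both sides of the printed inference. «Z ⊂ (y = 0)» for a closed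
subscheme is typed SET-theoretically (`y ∈ √I(Z)`) with the scheme-theoretic sibling (`y ∈ I(Z)`) — the text's
«vanishes identically along» (C58L48, C59L57) reads set-theoretically; flagged, both offered for (3). «birational» is
typed at ring level on the chart (OURS vocabulary `IsBirationalHom`: injective with the same total fraction ring),
faithful for a chart meeting the integral `Z̃†` (dense open). Scheme-level existence bullets («there exists a closed
subscheme … with an induced morphism to Z_Γ») become: `zIdeal ⊇` the ideal of `𝒱̃ ∩ 𝔙` (row 108 `vIdeal`) and the
Γ-ideal `I_{℘,Γ}` maps into `zIdeal` under the chart's structure map from `𝐔`'s coordinate ring (I-GA). The CHOICES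
the proof makes (Λ^det of C59L16–L25, G-H9; Z†° opens) are explicit parameters / a requirements-record
(`LambdaDetChoice`, «CHOICE — existence and independence of the choice NOT shown in print as a statement»).

## Items ↦ declarations (FQ prefix `Literature.AlgebraicGeometry.Hu2025.Statements.S07GammaSchemes.`)
* common: `GammaTransformChart`, `GammaTransformChart.DefinedBy`, `.Gamma0Maximal`, `.Gamma0Greatest`, `.gamma0Sat`,
  `.IsComponent`, `.ContainedInIff` (+ `_sch`), `IsBirationalHom`, `.Birational`, `.LiesOverGamma`.
* Lem. 7.3 C57L79–L139; p.129–130: `lambdaZeroRel` (C58L1–L2, relevant case), `LambdaDetChoice` (C59L16–L25; its field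
  `zero` = Λ^{=0} of the irrelevant case, C59L43–L53) + `LambdaDet`, `C58L13` (construction eq.: C58L8–L14 relevant /
  C59L61–L65 irrelevant case), `C58L64` (Γ̃⁰ update: C58L63–L66 / C59L72–L75), `Lem7_3_bullets`, `Lem7_3_1`,
  `Lem7_3_1max`, `Lem7_3_2`, `Lem7_3_3`, `Lem7_3`.
* Lem. 7.4 C59L145–C60L26; p.134–135: `Lem7_4_bullets`, `Lem7_4_1`, `Lem7_4_1max`, `Lem7_4_2`, `Lem7_4_3`
  (+ `Lem7_4_3_conseq`), `Lem7_4`; constructions `C60L53` (proper-transform case = strict transform), `C60L65`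
  (Γ̃ update), `C60L75` (the in-proof INFERENCE = JOINT J3), `C61L20` (Γ̄⁰ ∋ ζ), `C61L122` / `C61L150` ((⋆a) definitions),
  `C62L62` ((⋆b) definition).
* Lem. 7.5 C62L131–C63L33; p.140: `Lem7_5_bullets` (Γ̃⁰ ⊂ Var^∨, Γ̃¹ ⊂ Var), `Lem7_5_1` (+ `Lem7_5_1max`, sic note:
  (1) prints «Γ̃⁰_𝔙 ⊂ Var_𝔙» against the bullet's «⊂ Var^∨_𝔙» — `Lem7_5_1max_sicVar`), `Lem7_5_2`, `Lem7_5_3`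
  (+ `_conseq`), `Lem7_5`; construction `C66L72` (ℓ case: Γ̃⁰_𝔙 ∋ ζ_𝔙 = δ_{𝔙,(m,u_{F_k})} ∈ Var^∨_𝔙, C66L88–L90).
* Cor. 7.6 C66L106–L121; p.147: `Cor7_6`, `Cor7_6_birational` (last sentence C66L121, p.147 l.44–45).
Out of scope: the (⋆a)/(⋆b) rank conditions themselves (C61L84–L91: rank of the linear system (lin-ξ-ϑk) in y_1 at
general points of Z̃† — proof-internal case split; recorded as Prop parameters `starA`/`starB`), the scheme-level
objects Z̃_{•,Γ} as schemes with their morphisms (row 110).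
-/

noncomputable section

open scoped nonZeroDivisors

namespace Literature.AlgebraicGeometry.Hu2025.Statements.S07GammaSchemes

universe u v

/-! ## Common carrier: a Γ-transform seen on one chart -/

/-- **The data of a transform `Z̃_{•,Γ}` of the Γ-scheme on ONE chart `𝔙` (common shape of Lem. 7.3 bullets 1–3
C57L84–L100, Lem. 7.4 bullets C59L152–L167, Lem. 7.5 bullets C62L136–C63L2; p.129, p.134, p.140).** `A` = coordinate ring
of the chart, `V` = index type of its variables (`Var_𝔙`; for ℘/ℓ charts the same index type serves `Var^∨_𝔙`, row 108
`WpEllChart.var` / `.varVee`). Fields: the chart ideal `zIdeal` of `Z̃_{•,Γ} ∩ 𝔙` («there exists a closed subscheme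
Z̃_{•,Γ} of 𝒱̃_•»), the chart ideal `zDagger` of the component `Z̃†_{•,Γ} ∩ 𝔙` («comes equipped with an irreducible
component Z̃†»), and the two index sets `gamma0 = Γ̃⁰_𝔙`, `gamma1 = Γ̃¹_𝔙` («there are two subsets, possibly empty,
Γ̃⁰_𝔙 ⊂ Var_𝔙, Γ̃¹_𝔙 ⊂ Var_𝔙»; Lem. 7.3 has `Γ̃¹ = ∅`, C60L40 «where we set Γ̃¹_𝔙 = ∅»). The record asserts nothing;
EXISTENCE with the properties below is the content of the lemmas.
[claim: Hu2025, status: under-review]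
STATUS: candidate statement under adjudication (D-0012/D-0089); not asserted. -/
structure GammaTransformChart (V : Type v) (A : Type u) [CommRing A] where
  /-- chart ideal of `Z̃_{•,Γ} ∩ 𝔙` -/
  zIdeal : Ideal A
  /-- chart ideal of the irreducible component `Z̃†_{•,Γ} ∩ 𝔙` -/
  zDagger : Ideal A
  /-- `Γ̃⁰_𝔙` (indices of variables set to `0`) — PARTITION name `GammaTilde0` -/
  gamma0 : Finset V
  /-- `Γ̃¹_𝔙` (indices of variables set to `1`) — PARTITION name `GammaTilde1` -/
  gamma1 : Finset V

/-- PARTITION-HU row 109 expected name for the carrier `Γ̃⁰_𝔙` (Lem. 7.3/7.4/7.5 third bullet).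
[claim: Hu2025, status: under-review]
STATUS: candidate statement under adjudication (D-0012/D-0089); not asserted. -/
abbrev GammaTilde0 {V : Type*} {A : Type*} [CommRing A] (D : GammaTransformChart V A) : Finset V := D.gamma0

/-- PARTITION-HU row 109 expected name for the carrier `Γ̃¹_𝔙` (Lem. 7.4/7.5 third bullet; `∅` in Lem. 7.3).
[claim: Hu2025, status: under-review]
STATUS: candidate statement under adjudication (D-0012/D-0089); not asserted. -/
abbrev GammaTilde1 {V : Type*} {A : Type*} [CommRing A] (D : GammaTransformChart V A) : Finset V := D.gamma1

namespace GammaTransformChart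

variable {V : Type*} {A : Type*} [CommRing A]

/-- **«is defined by the following relations y (y ∈ Γ̃⁰_𝔙), y − 1 (y ∈ Γ̃¹_𝔙), ⟨the listed families⟩»** (Lem. 7.3 (1)
C57L109–L125; Lem. 7.4 (1) = eq. (7.12) C60L4–L13; Lem. 7.5 (1) C63L8–L17; Cor. 7.6 C66L111–L120) — the common
predicate, for a reading `val0 : V → A` of the symbols in `Γ̃⁰` (the `Var_𝔙`-variable, or for Lem. 7.5 / Cor. 7.6 the
`Var^∨_𝔙`-function), `val1 : V → A` for `Γ̃¹`, an index set `G0` in the `Γ̃⁰` slot, and the relation families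
flattened into ONE family `rels : ι → A` of chart elements (DATA: AS PRINTED the term-wise proper transforms).
[claim: Hu2025, status: under-review]
STATUS: candidate statement under adjudication (D-0012/D-0089); not asserted. -/
def DefinedByWith (D : GammaTransformChart V A) {ι : Type*} (val0 val1 : V → A) (rels : ι → A) (G0 : Finset V) : Prop :=
  D.zIdeal =
    Ideal.span ((val0 '' (G0 : Set V)) ∪ ((fun y => val1 y - 1) '' (D.gamma1 : Set V)) ∪ Set.range rels)

/-- **Item (1) of Lem. 7.3 / 7.4 / 7.5 and Cor. 7.6 at the chart's own `Γ̃⁰_𝔙`** (see `DefinedByWith`).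
[claim: Hu2025, status: under-review]
STATUS: candidate statement under adjudication (D-0012/D-0089); not asserted. -/
def DefinedBy (D : GammaTransformChart V A) {ι : Type*} (val0 val1 : V → A) (rels : ι → A) : Prop := D.DefinedByWith val0 val1 rels D.gamma0

/-- **«further, we take Γ̃⁰_𝔙 ⊂ Var_𝔙 to be the maximal subset (under inclusion) among all those subsets that
satisfy the above»** (Lem. 7.3 C57L127–L129; Lem. 7.4 (1) C60L15–L17; Lem. 7.5 (1) C63L19–L21) — MAXIMAL-ELEMENT
reading: `Γ̃⁰_𝔙` satisfies (1) and no strictly larger index set does.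
[claim: Hu2025, status: under-review]
STATUS: candidate statement under adjudication (D-0012/D-0089); not asserted. -/
def Gamma0Maximal (D : GammaTransformChart V A) {ι : Type*} (val0 val1 : V → A) (rels : ι → A) : Prop :=
  D.DefinedBy val0 val1 rels ∧ ∀ G : Finset V, D.DefinedByWith val0 val1 rels G → D.gamma0 ⊆ G → G = D.gamma0

/-- Same sentence, GREATEST-ELEMENT reading («the maximal subset» as the largest one): every index set satisfying (1)
is contained in `Γ̃⁰_𝔙`. Sibling of `Gamma0Maximal` (the text's definite article suggests uniqueness; which reading
the lanes adopt is theirs).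
[claim: Hu2025, status: under-review]
STATUS: candidate statement under adjudication (D-0012/D-0089); not asserted. -/
def Gamma0Greatest (D : GammaTransformChart V A) {ι : Type*} (val0 val1 : V → A) (rels : ι → A) : Prop :=
  D.DefinedBy val0 val1 rels ∧ ∀ G : Finset V, D.DefinedByWith val0 val1 rels G → G ⊆ D.gamma0

/-- Same sentence read as an OBJECT rather than a claim (OURS vocabulary; DEFINITION reading of «we take Γ̃⁰_𝔙 ⊂ Var_𝔙
to be the maximal subset (under inclusion) among all those subsets that satisfy the above», Lem. 7.3 (1) C57L127–L129,
Lem. 7.4 (1) C60L15–L17, Lem. 7.5 (1) C63L19–L21): the set of indices whose `val0`-reading lies in the chart ideal of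
`Z̃ ∩ 𝔙` («y vanishes on Z̃ ∩ 𝔙» scheme-theoretically). Sibling of the CLAIM readings `Gamma0Maximal` /
`Gamma0Greatest`, which speak about the record's own `gamma0` (the sets built by (7.6)/(7.11)/(7.13)); which reading the
lanes adopt is theirs. [claim: Hu2025, status: under-review]
STATUS: candidate statement under adjudication (D-0012/D-0089); not asserted. -/
def gamma0Sat (D : GammaTransformChart V A) (val0 : V → A) : Set V :=
  {y | val0 y ∈ D.zIdeal}

/-- **«Z̃_{•,Γ} comes equipped with an irreducible component Z̃†_{•,Γ}»** (second bullet of Lem. 7.3 C57L91–L94, Lem. 7.4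
C59L158–L161, Lem. 7.5 C62L143–L146) on the chart: `zDagger` is a minimal prime over `zIdeal` (the component with
its reduced structure; the text treats `Z̃†` as integral, «birational to Z_Γ», C58L40). Charts missing `Z̃†`: `zDagger = ⊤`
is allowed by the guard.
[claim: Hu2025, status: under-review]
STATUS: candidate statement under adjudication (D-0012/D-0089); not asserted. -/
def IsComponent (D : GammaTransformChart V A) : Prop := D.zDagger ≠ ⊤ → D.zDagger ∈ D.zIdeal.minimalPrimes

/-- **Item (3), SET-theoretic reading** (Lem. 7.3 (3) C57L135–L139; Lem. 7.4 (3) C60L21–L22; Lem. 7.5 (3) C63L25–L26):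
«for any variable y ∈ Var_𝔙, Z̃† ∩ 𝔙 ⊂ (y = 0) if and only if Z̃ ∩ 𝔙 ⊂ (y = 0)» — containment of closed SUBSETS:
`var y ∈ √zDagger ↔ var y ∈ √zIdeal` (the text's «vanishes identically along», C58L48/C59L57).
[claim: Hu2025, status: under-review]
STATUS: candidate statement under adjudication (D-0012/D-0089); not asserted. -/
def ContainedInIff (D : GammaTransformChart V A) (var : V → A) : Prop :=
  D.zDagger ≠ ⊤ → ∀ y : V, var y ∈ D.zDagger.radical ↔ var y ∈ D.zIdeal.radical

/-- **Item (3), SCHEME-theoretic sibling:** `var y ∈ zDagger ↔ var y ∈ zIdeal` (containment of closed subschemes).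
[claim: Hu2025, status: under-review]
STATUS: candidate statement under adjudication (D-0012/D-0089); not asserted. -/
def ContainedInIff_sch (D : GammaTransformChart V A) (var : V → A) : Prop :=
  D.zDagger ≠ ⊤ → ∀ y : V, var y ∈ D.zDagger ↔ var y ∈ D.zIdeal

/-- **«Z̃_{•,Γ} is a closed subscheme of 𝒱̃_•» with «an induced morphism Z̃_{•,Γ} → Z_Γ»** (first bullet of each lemma,
C57L84–L89, C59L152–L156, C62L138–L141) on the chart: `zIdeal` contains the chart ideal `vIdeal` of `𝒱̃_• ∩ 𝔙` (row 108
`WpEllChart.vIdeal`; rows 103–106 for `𝒱_[k]`, `𝒱̃_{ϑ[k]}`), and the Γ-ideal `I_{℘,Γ} ⊂ 𝔽[x_u]` (I-GA `gammaWpIdeal`)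
maps into `zIdeal` under the chart's structure map `base` from `𝐔`'s coordinate ring (the chart lies over `𝐔`; row 106
`ChartSeq.pullback`), so that `Z̃ ∩ 𝔙 → Z_Γ` exists.
[claim: Hu2025, status: under-review]
STATUS: candidate statement under adjudication (D-0012/D-0089); not asserted. -/
def LiesOverGamma (D : GammaTransformChart V A) {R₀ : Type*} [CommRing R₀] (base : R₀ →+* A) (gammaWp : Ideal R₀) (vIdeal : Ideal A) : Prop :=
  vIdeal ≤ D.zIdeal ∧ gammaWp.map base ≤ D.zIdeal

end GammaTransformChart

/-- **«birational» at ring level (OURS vocabulary for item (2)).** For a ring map `f : B → C` (here: Γ-scheme ring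
`𝔽[x_u]/I_{℘,Γ}` → coordinate ring `A ⧸ zDagger` of `Z̃† ∩ 𝔙`): `f` is injective and every element of `C` is a
fraction of images (`c · f b' = f b` with `f b'` a non-zero-divisor) — the induced map of total fraction rings is an
isomorphism. Faithful for the printed «Z̃† → Z_Γ is birational» on a chart MEETING the integral `Z̃†` (dense open).
[claim: Hu2025, status: under-review]
STATUS: candidate statement under adjudication (D-0012/D-0089); not asserted. -/
def IsBirationalHom {B C : Type*} [CommRing B] [CommRing C] (f : B →+* C) : Prop :=
  Function.Injective f ∧ ∀ c : C, ∃ b b' : B, f b' ∈ C⁰ ∧ c * f b' = f b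

namespace GammaTransformChart

variable {V : Type*} {A : Type*} [CommRing A]

/-- **Item (2): «the induced morphism Z̃†_{•,Γ} → Z_Γ is birational»** (Lem. 7.3 (2) C57L131–L133; Lem. 7.4 (2) C60L19;
Lem. 7.5 (2) C63L23) on a chart meeting `Z̃†`: with `RΓ` the Γ-scheme ring (I-GA `GammaSchemeRing 𝔉 Γ`) and `φ` the
induced ring map `RΓ → A ⧸ zDagger` (exists by `LiesOverGamma`; supplied as data), `φ` is birational (`IsBirationalHom`).
[claim: Hu2025, status: under-review]
STATUS: candidate statement under adjudication (D-0012/D-0089); not asserted. -/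
def Birational (D : GammaTransformChart V A) {RΓ : Type*} [CommRing RΓ] (φ : RΓ →+* A ⧸ D.zDagger) : Prop :=
  D.zDagger ≠ ⊤ → IsBirationalHom φ

end GammaTransformChart

/-! ## Lem. 7.3 — 𝔉-transforms in `𝒱_[k] ⊂ ℛ_[k]` (charts = affine spaces of rows 103/104) -/

section Lem73

variable {σ : Type*} {T : Type*} {𝔗 : Type*}

/-- **`Λ⁰_{F_k,Γ}` in the Γ-RELEVANT case (display C58L1–L2 = PDF eq. (7.2) p.130, after C57L166 «First, we suppose F_k is
Γ-relevant»).** «Λ^{=0}_{F_k,Γ} := {x_{(u,v)} ∈ Λ_{F_k} ∣ x_u or x_v ∈ Γ}» (C58L6: «recall the convention x_{(u,v)} = x_{(v,u)}»).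
Typed over I-R's term index `T` (`rel : T → 𝔉`, `ends t = (u_t, v_t)`, res-type-024 `Eq4_1`) and `Γ ⊂ Var_𝐔` as a
set of ϖ-indices: the terms of `F` one of whose end-variables lies in `Γ`. REAL definition.
[claim: Hu2025, status: under-review]
STATUS: candidate statement under adjudication (D-0012/D-0089); not asserted. -/
def lambdaZeroRel (rel : T → 𝔗) (ends : T → σ × σ) (F : 𝔗) (Γ : Set σ) : Set T :=
  {t | rel t = F ∧ ((ends t).1 ∈ Γ ∨ (ends t).2 ∈ Γ)}

/-- **The Λ^det CHOICE of the Γ-IRRELEVANT case (C59L16–L25; p.132; displays C59L29–L31 = PDF eq. (7.7), C59L45–L47 =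
(7.8), C59L56–L59 = (7.9); lit/PARTITION-HU.md §6 (d), G-H9) — requirements record.** «We can let Λ^det_{F_k,Γ} be the subset of Λ_{F_k} such that the minor corresponding to variables
{x_{𝔙,(u,v)} ∣ (u,v) ∈ Λ^det_{F_k,Γ}} achieves the maximal rank of the linear system {L_{F_k}, ℬ^frb_{[k]}}, regarded as
relations in ϱ-variables of F_k, at any point of some fixed Zariski open subset Z†°_{𝔉[k−1],Γ} of Z†_{𝔉[k−1],Γ}.» Then
(C59L43–L53): «Λ^{=0}_{F_k,Γ} ⊂ Λ_{F_k} … the subset consisting of (u,v) ∉ Λ^det_{F_k,Γ} and (u,v) ∈ Λ^det_{F_k,Γ} such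
that x_{(u,v)} ≡ 0 over Z†°_{𝔉[k−1],Γ}». Typed as DATA (`det`, `zero` ⊂ the terms of `F_k`) with the two printed
requirements as Prop-valued fields over explicit predicates `AchievesMaxRank` (the minor condition on the open `Z†°`)
and `VanishesOnDaggerOpen` («x_{(u,v)} ≡ 0 over Z†°») supplied by the instantiation — a CHOICE: neither uniqueness nor
independence of the choice is stated in print.
[claim: Hu2025, status: under-review]
STATUS: candidate statement under adjudication (D-0012/D-0089); not asserted. -/
structure LambdaDetChoice (rel : T → 𝔗) (F : 𝔗) (AchievesMaxRank : Finset T → Prop)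
    (VanishesOnDaggerOpen : T → Prop) where
  /-- `Λ^det_{F_k,Γ} ⊂ Λ_{F_k}` (C59L17) -/
  det : Finset T
  /-- `Λ^{=0}_{F_k,Γ} ⊂ Λ_{F_k}` of the irrelevant case (C59L45–L53) -/
  zero : Finset T
  /-- both are sets of terms of `F_k` -/
  det_rel : ∀ t ∈ det, rel t = F
  /-- «the minor corresponding to variables {x_{𝔙,(u,v)} ∣ (u,v) ∈ Λ^det} achieves the maximal rank … at any point of
  … Z†°» (C59L18–L25) -/
  det_maxRank : AchievesMaxRank det
  /-- «Λ^{=0} … consisting of (u,v) ∉ Λ^det and (u,v) ∈ Λ^det such that x_{(u,v)} ≡ 0 over Z†°» (C59L50–L53) -/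
  zero_spec : ∀ t, t ∈ zero ↔ rel t = F ∧ (t ∉ det ∨ (t ∈ det ∧ VanishesOnDaggerOpen t))

/-- PARTITION-HU row 109 expected name `LambdaDet`: the chosen set `Λ^det_{F_k,Γ}` of a `LambdaDetChoice`.
[claim: Hu2025, status: under-review]
STATUS: candidate statement under adjudication (D-0012/D-0089); not asserted. -/
abbrev LambdaDet {rel : T → 𝔗} {F : 𝔗} {P : Finset T → Prop} {Q : T → Prop} (c : LambdaDetChoice rel F P Q) :
    Finset T := c.det

variable {A A' : Type*} [CommRing A] [CommRing A']

/-- **Construction of the 𝔉-transform, eq. (construction-ZkGa) (C58L8–L14 relevant case = PDF eq. (7.3) p.130; C59L61–L65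
irrelevant case = PDF eq. (7.10) p.133):** «Z_{𝔉[k],Γ} = ρ_{[k]}^{-1}(Z_{𝔉[k−1],Γ}) ∩ (x_{(u,v)} = 0 ∣ (u,v) ∈ Λ^{=0}_{F_k,Γ})» (scheme-theoretic
pre-image and intersection). On a chart `𝔙` of `ℛ_[k]` over `𝔙'` of `ℛ_{𝔉[k−1]}` (ring map `ρ : A' → A`, row 103/104
charts; C58L74–L77 «ρ^{-1}(Z) ∩ 𝔙 = π^{-1}(Z) ∩ 𝒱_[k] ∩ 𝔙»): the new chart ideal is the extension of the old one plus
the ideal of `𝒱_[k] ∩ 𝔙` plus the de-homogenised ϱ-variables `xRho t`, `t ∈ Λ^{=0}`.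
[claim: Hu2025, status: under-review]
STATUS: candidate statement under adjudication (D-0012/D-0089); not asserted. -/
def C58L13 (ρ : A' →+* A) (vIdeal : Ideal A) (xRho : T → A) (lambdaZero : Set T) (zIdeal' : Ideal A')
    (zIdeal : Ideal A) : Prop :=
  zIdeal = zIdeal'.map ρ ⊔ vIdeal ⊔ Ideal.span (xRho '' lambdaZero)

/-- **Γ̃⁰ update along an 𝔉-step (C58L63–L66 relevant case = PDF eq. (7.6) p.131 «Γ̃⁰_𝔙 = Γ̃⁰_{𝔙'} ⊔ {x_{(u,v)} ∈ Λ_{F_k} ∣ x_u or x_v ∈ Γ}»;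
C59L72–L75 irrelevant case = PDF eq. (7.11) p.133 «Γ̃⁰_𝔙 = Γ̃⁰_{𝔙'} ⊔ {x_{𝔙,(u,v)} ∣ (u,v) ∈ Λ^{=0}_{F_k,Γ}}»).** Typed on indices:
with `Var_𝔙 ⊇ Var_{𝔙'}` along the inclusion `ι : V' ↪ V` of index types (the chart of `ℛ_[k]` adds the ϱ-variables of
`F_k`, row 103 `Prop4_54`) and `idxRho : T → V` the index of `x_{𝔙,(u,v)}`: `Γ̃⁰_𝔙 = ι(Γ̃⁰_{𝔙'}) ∪ idxRho(Λ^{=0})`.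
[claim: Hu2025, status: under-review]
STATUS: candidate statement under adjudication (D-0012/D-0089); not asserted. -/
def C58L64 {V V' : Type*} [DecidableEq V] (ι : V' → V) (idxRho : T → V) (lambdaZero : Finset T)
    (gamma0' : Finset V') (gamma0 : Finset V) : Prop :=
  gamma0 = gamma0'.image ι ∪ lambdaZero.image idxRho

/-- **Lemma 7.3, the three bullets (C57L79–L100; p.129).** «Fix any subset Γ of 𝐔 [sic: of Var_𝐔, cf. Def. 7.1 C57L10]. Assume that Z_Γ is integral. Fix and
consider any k ∈ [Υ]. Then, we have the following: • there exists a closed subscheme Z_{𝔉[k],Γ} of 𝒱_[k] with an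
induced morphism Z_{𝔉[k],Γ} → Z_Γ; • Z_{𝔉[k],Γ} comes equipped with an irreducible component Z†_{𝔉[k],Γ} with the induced
morphism Z†_{𝔉[k],Γ} → Z_Γ; • for any standard chart 𝔙 of ℛ_[k] such that Z_{[k],Γ} ∩ 𝔙 ≠ ∅, there exists a subset,
possibly empty, Γ̃⁰_𝔙 ⊂ Var_𝔙.» Typed per chart over the record `D` (with `Γ̃¹_𝔙 = ∅`, C60L40): the hypothesis
«Z_Γ is integral» is `hInt` (I-GA: `I_{℘,Γ}` prime), the chart meets `Z_{[k],Γ}` (`zIdeal ≠ ⊤`), and the existence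
content = `LiesOverGamma` ∧ `IsComponent` ∧ `gamma1 = ∅`.
[claim: Hu2025, status: under-review]
STATUS: candidate statement under adjudication (D-0012/D-0089); not asserted. -/
def Lem7_3_bullets {V : Type*} {R₀ : Type*} [CommRing R₀] (hInt : Prop) (base : R₀ →+* A) (gammaWp : Ideal R₀)
    (vIdeal : Ideal A) (D : GammaTransformChart V A) : Prop :=
  hInt → D.zIdeal ≠ ⊤ → D.LiesOverGamma base gammaWp vIdeal ∧ D.IsComponent ∧ D.gamma1 = ∅

/-- **Lemma 7.3 (1) (C57L107–L125 = PDF item (1), display eq. (7.1); p.129–130).** «The scheme Z_{[k],Γ} ∩ 𝔙, as a closed subscheme of the chart 𝔙, is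
defined by the following relations: y, y ∈ Γ̃⁰_𝔙; ℬ^frb_{𝔙,[k]}; B_{𝔙,(s,t)}: x_{𝔙,(u_s,v_s)} x_{𝔙,u_t} x_{𝔙,v_t} −
x_{𝔙,(u_t,v_t)} x_{𝔙,u_s} x_{𝔙,v_s}, s, t ∈ S_{F_i}, i ∈ [k]; L_{𝔙,F_i}: Σ_{s ∈ S_{F_i}} sgn(s) x_{𝔙,(u_s,v_s)}, i ∈ [k];
F̄_{𝔙,j}: Σ_{s ∈ S_{F_j}} sgn(s) x_{𝔙,u_s} x_{𝔙,v_s}, k < j ≤ Υ.» Typed with the four families flattened into `rels`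
(DATA on the chart = row 103/104's `Prop4_56` relations; conventions `x_{(u_{s_{F_i,o}}, v_{s_{F_i,o}})} ≡ 1`, `x_m = 1`)
and `Γ̃¹ = ∅`; `var : V → A` = the chart variables (`X`).
[claim: Hu2025, status: under-review]
STATUS: candidate statement under adjudication (D-0012/D-0089); not asserted. -/
def Lem7_3_1 {V : Type*} {ι : Type*} (hInt : Prop) (var : V → A) (rels : ι → A) (D : GammaTransformChart V A) : Prop :=
  hInt → D.zIdeal ≠ ⊤ → D.DefinedBy var var rels

/-- **Lemma 7.3 (1), maximality clause (C57L127–L129; p.130).** «Further, we take Γ̃⁰_𝔙 ⊂ Var_𝔙 to be the maximal subset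
(under inclusion) among all those subsets that satisfy the above.» (`Gamma0Maximal`; greatest-element sibling
available as `GammaTransformChart.Gamma0Greatest`.)
[claim: Hu2025, status: under-review]
STATUS: candidate statement under adjudication (D-0012/D-0089); not asserted. -/
def Lem7_3_1max {V : Type*} {ι : Type*} (hInt : Prop) (var : V → A) (rels : ι → A) (D : GammaTransformChart V A) : Prop :=
  hInt → D.zIdeal ≠ ⊤ → D.Gamma0Maximal var var rels

/-- **Lemma 7.3 (2) (C57L131–L133; p.130).** «The induced morphism Z†_{𝔉[k],Γ} → Z_Γ is birational.»
[claim: Hu2025, status: under-review]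
STATUS: candidate statement under adjudication (D-0012/D-0089); not asserted. -/
def Lem7_3_2 {V : Type*} {RΓ : Type*} [CommRing RΓ] (hInt : Prop) (D : GammaTransformChart V A)
    (φ : RΓ →+* A ⧸ D.zDagger) : Prop :=
  hInt → D.Birational φ

/-- **Lemma 7.3 (3) (C57L135–L139; p.130).** «For any variable y = x_{𝔙,u} or y = x_{𝔙,(u,v)} ∈ Var_𝔙,
Z†_{[k],Γ} ∩ 𝔙 ⊂ (y = 0) if and only if Z_{[k],Γ} ∩ 𝔙 ⊂ (y = 0). (We remark here that this property is not used within
this lemma, but will be used as the initial case of Lemma 7.4.)» SET-theoretic reading (`ContainedInIff`;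
scheme-theoretic sibling `GammaTransformChart.ContainedInIff_sch`).
[claim: Hu2025, status: under-review]
STATUS: candidate statement under adjudication (D-0012/D-0089); not asserted. -/
def Lem7_3_3 {V : Type*} (hInt : Prop) (var : V → A) (D : GammaTransformChart V A) : Prop :=
  hInt → D.ContainedInIff var

/-- **Lemma 7.3 (C57L79–L139; p.129–130)** = bullets ∧ (1) with maximality ∧ (2) ∧ (3) on the chart.
[claim: Hu2025, status: under-review]
STATUS: candidate statement under adjudication (D-0012/D-0089); not asserted. -/
def Lem7_3 {V : Type*} {ι : Type*} {R₀ RΓ : Type*} [CommRing R₀] [CommRing RΓ] (hInt : Prop) (base : R₀ →+* A)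
    (gammaWp : Ideal R₀) (vIdeal : Ideal A) (var : V → A) (rels : ι → A) (D : GammaTransformChart V A)
    (φ : RΓ →+* A ⧸ D.zDagger) : Prop :=
  Lem7_3_bullets hInt base gammaWp vIdeal D ∧ Lem7_3_1 hInt var rels D ∧ Lem7_3_1max hInt var rels D ∧
    Lem7_3_2 hInt D φ ∧ Lem7_3_3 hInt var D

end Lem73

end Literature.AlgebraicGeometry.Hu2025.Statements.S07GammaSchemes

end
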